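import Literature.IUT.HodgeArakelov.BadPrimeGaussianMonoidsInftyRestrictionProofs

/-!
# [IUTchII] Cor 3.6 (ii)/(iii), `∞`-level: the Frobenioid-theoretic `∞`-Gaussian monoid `∞Ψ_{F_ξ}(†F_v)` of the
# printed `∞Ψ_ξ` and its splitting `(Ψ^×_{†C_v})_{⟨F_l^⋇⟩} · Im(ξ)^{ℚ≥0}` — proof companion of `BadPrimeGaussianMonoids.lean`

S. Mochizuki, *Inter-universal Teichmüller theory II*, §3, kurims Dec-2020 manuscript, Cor 3.6 (ii) p. 99–100
("`Ψ_{F_ξ}(†F_v) ⊆ ∞Ψ_{F_ξ}(†F_v) ⊆ ∏_{|t|} (Ψ_{†C_v})_{|t|}` … the submonoids determined, respectively, via the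
isomorphisms `(Ψ_{†C_v})_{|t|} ⥲ Ψ_cns(M^Θ_*)_{|t|}` of (i), by the monoids `Ψ_ξ(M^Θ_*)`, `∞Ψ_ξ(M^Θ_*)`") and (iii) p. 100
("splittings up to torsion … `∞Ψ_{F_ξ}(†F_v) = (Ψ^×_{†C_v})_{⟨F_l^⋇⟩} · Im(ξ)^{ℚ≥0}` — where `Im(ξ)` denotes the image of
`ξ` via the isomorphisms discussed in (ii)") [cite: Mochizuki2012, Cor 3.6 (iii) p.100]. Claim key DISPUTED
(D-0012). PROOF-ONLY companion (abc-iut cell, layer L6, seat abc-iut-w5-d031; `∞`-level sibling of abc-iut-L6-t2's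
`frobenioidGaussianMonoid_eq` for the printed `∞Ψ_ξ = unitDiagonal ⊔ closure (restrictions of ∞θ^ι_env)` of
`BadPrimeGaussianMonoidsInftyRestrictionProofs.lean`; node rows IUTchII:Cor3.6(ii)/(iii) `∞`-clauses, statement
file's `inftyFrobenioidGaussianMonoid` being the over-approximate sibling). NO definition, NO `Prop` fact: the
Frobenioid-theoretic copy is written as the pull-back `(…).comap (piIso T e)` exactly as in the statement file.
Nothing here asserts a disputed claim or takes a side on [IUTchIII] Cor 3.12; typed ≠ proved ≠ endorsed.
-/

namespace Literature.IUT.HodgeArakelov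

namespace BadPrimeGaussianMonoids

universe u v w

variable {T : Type u} {M : Type v} [CommMonoid M] {N : Type w} [CommMonoid N]

/-- **IUTchII:Cor3.6(iii)** (kurims p.100) "`∞Ψ_{F_ξ}(†F_v) = (Ψ^×_{†C_v})_{⟨F_l^⋇⟩} · Im(ξ)^{ℚ≥0}`": pulling the printed
`∞Ψ_ξ = Ψ^×_{⟨F_l^⋇⟩} · ⟨X⟩` (`X` = the restrictions of `∞θ^ι_env`) back along the labeled Kummer copies `piIso T e` gives
the unit diagonal of `Ψ_{†C_v}` times the submonoid generated by the `e⁻¹`-images `Im(X)`.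
[cite: Mochizuki2012, Cor 3.6 (iii) p.100] -/
theorem comap_piIso_unitDiagonal_sup_closure (e : N ≃* M) (X : Set (T → M)) :
    (unitDiagonal T M ⊔ Submonoid.closure X).comap (piIso T e).toMonoidHom =
      unitDiagonal T N ⊔ Submonoid.closure ((piIso T e).symm '' X) := by
  have hc : (unitDiagonal T M ⊔ Submonoid.closure X).comap (piIso T e).toMonoidHom =
      (unitDiagonal T M ⊔ Submonoid.closure X).map (piIso T e).symm.toMonoidHom := by
    ext x
    simp only [Submonoid.mem_comap, Submonoid.mem_map_equiv, MulEquiv.symm_symm, MulEquiv.coe_toMonoidHom]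
  have hsymm : piIso T e.symm = (piIso T e).symm := rfl
  rw [hc, Submonoid.map_sup, MonoidHom.map_mclosure, ← hsymm, map_piIso_unitDiagonal]
  rfl

/-- **IUTchII:Cor3.6(ii)** (kurims p.100), `∞`-level: the Frobenioid-theoretic `∞`-Gaussian monoid — the pull-back of
the printed `∞Ψ_ξ` along `piIso T e` — CONTAINS the Frobenioid-theoretic Gaussian monoid `Ψ_{F_ξ}` of the statement
file (`frobenioidGaussianMonoid e ξ`, the pull-back of `Ψ_ξ`) whenever `ξ ∈ X` (the vertical inclusion
`Ψ_{F_ξ} ⊆ ∞Ψ_{F_ξ}` of the third display). [cite: Mochizuki2012, Cor 3.6 (ii) p.100] -/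
theorem frobenioidGaussianMonoid_le_comap_inftyArising (e : N ≃* M) {X : Set (T → M)} {ξ : T → M}
    (hξ : ξ ∈ X) :
    frobenioidGaussianMonoid e ξ ≤ (unitDiagonal T M ⊔ Submonoid.closure X).comap (piIso T e).toMonoidHom := by
  refine Submonoid.monotone_comap (sup_le_sup_left ?_ _)
  rw [Submonoid.powers_le]
  exact Submonoid.subset_closure hξ

/-- **IUTchII:Cor3.6(ii)/(iii)** (kurims p.100), `∞`-level: the pull-back of the printed `∞Ψ_ξ` sits inside the
statement file's over-approximate `inftyFrobenioidGaussianMonoid e ξ` (pull-back of `Ψ^× · ξ^{ℚ≥0}` with ALL roots)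
whenever the printed `∞Ψ_ξ` sits inside `inftyGaussianMonoid ξ` (cf. `inftyArising_le_inftyGaussianMonoid`).
[cite: Mochizuki2012, Cor 3.6 (iii) p.100] -/
theorem comap_inftyArising_le_inftyFrobenioidGaussianMonoid (e : N ≃* M) {X : Set (T → M)} {ξ : T → M}
    (hle : unitDiagonal T M ⊔ Submonoid.closure X ≤ inftyGaussianMonoid ξ) :
    (unitDiagonal T M ⊔ Submonoid.closure X).comap (piIso T e).toMonoidHom ≤
      inftyFrobenioidGaussianMonoid e ξ :=
  Submonoid.monotone_comap hle

/-! ### (v2) The root hypothesis `hroot` from the `μ_{2l}`-torsor law of `∞θ^ι_env` -/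

/-- **IUTchII:Cor3.5(ii)** (kurims p.95; Rmk 2.5.1: `θ^ι_env` is a `μ_{2l}`-orbit, `∞θ^ι_env` its `N`-th roots): if every
element `x` of `Θ = ∞θ^ι_env` satisfies `x^N = ζ · θ` for some `N ≥ 1` and some `2l`-torsion `ζ`, then `x^{N·2l} = θ^{2l}` —
the hypothesis `hroot` of `inftyArising_le_inftyGaussianMonoid(_thetaEnv)` / `injective_restriction_of_not_isUnit`
(audit note abc-iut-w4-d022 on p413084, LOW). [cite: Mochizuki2012, Cor 3.5 (ii) p.95] -/
theorem hroot_of_torsorLaw {A : Type u} [CommMonoid A] (θ : A) (Θ : Set A) {twoL : ℕ} (h0 : 0 < twoL)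
    (hlaw : ∀ x ∈ Θ, ∃ (n : ℕ) (ζ : A), 0 < n ∧ ζ ^ twoL = 1 ∧ x ^ n = ζ * θ) :
    ∀ x ∈ Θ, ∃ a b : ℕ, 0 < a ∧ 0 < b ∧ x ^ a = θ ^ b := by
  intro x hx
  obtain ⟨n, ζ, hn, hζ, hxn⟩ := hlaw x hx
  refine ⟨n * twoL, twoL, Nat.mul_pos hn h0, h0, ?_⟩
  rw [pow_mul, hxn, mul_pow, hζ, one_mul]

end BadPrimeGaussianMonoids

end Literature.IUT.HodgeArakelov
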